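import Literature.AlgebraicTopology.SingularHomology.HomotopyAddition
import Literature.AlgebraicTopology.SingularHomology.CubeSimplexCollapse
import Literature.AlgebraicTopology.Homotopy.CubicalHomotopyAddition
import HarnessLib

/-!
# Proof of the homotopy addition theorem (`homotopyAddition`)

Topic `Literature/AlgebraicTopology/SingularHomology`, sibling proof file of `HomotopyAddition.lean`
(the named fact `Literature.AlgebraicTopology.SingularHomology.homotopyAddition`, Spanier,
*Algebraic Topology* (1981), Ch. 7 §5 Prop. 3 in the form consumed by the Hurewicz theorem).
This file DISCHARGES it:

* `Literature.AlgebraicTopology.SingularHomology.homotopyAddition_holds : homotopyAddition`.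

The device (the `cls` of `HomotopyAdditionData`) is the class `collapseClass g hg = [g ∘ κₙ]` of
a based singular simplex `g : (Δⁿ, ∂Δⁿ) → (X, x₀)` read through the collapse `κₙ : Iⁿ → Δⁿ` of
`CubeSimplexCollapse.lean` (Spanier p. 391 replaces `(Iⁿ, İⁿ)` by `(Δⁿ, Δ̇ⁿ)` through a
homeomorphism; a relative homeomorphism serves as well):

* (i) `collapseClass_surjective` — every element of `πₙ(X, x₀)` is such a class: a generalized
  loop `p : (Iⁿ, ∂Iⁿ) → (X, x₀)` is constant on the fibres of the quotient map `κₙ` (singletons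
  off `∂Iⁿ`, subsets of `∂Iⁿ` otherwise), hence factors as `g ∘ κₙ`
  (`Topology.IsQuotientMap.lift`);
* (ii) `collapseClass_const` — the constant simplex has trivial class;
* (iii) `prod_collapseClass_face_zpow_eq_one` — **the homotopy addition theorem**: for
  `τ : Δᵏ⁺³ → X` constant on the `(k+1)`-skeleton, `∏ᵢ [τ ∘ δᵢ]^((-1)ⁱ) = 1` in `π_{k+2}(X, x₀)`.
  Proof: the singular cube `τ ∘ κ_{k+3}` is constant on the codimension-two skeleton of the cube
  (`collapse_mem_stdSkel_of_two`), so the cubical homotopy addition theorem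
  (`Homotopy.CubeHAT.altProd_eq_one`, `Homotopy/CubicalHomotopyAddition.lean`) applies to it; its
  faces `{tⱼ = 1}` are the faces `τ ∘ δⱼ ∘ κ`, `j ≤ k + 2` (`collapse_insertNth_one`), its face
  `{t_{k+2} = 0}` is `τ ∘ δ_{k+3} ∘ κ` (`collapse_insertNth_last_zero`), and its faces `{tⱼ = 0}`,
  `j < k + 2`, are constant (`collapse_insertNth_zero_mem_stdSkel`); the cubical alternating
  product is then literally `∏ᵢ [τ ∘ δᵢ]^((-1)ⁱ)`.

Everything is proved; nothing is asserted.

## References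

* E. H. Spanier, *Algebraic Topology*, Springer (1981), Ch. 7 §4 p. 391, §5 Prop. 3 and part (d)
  of the proof of Thm. 7.5.4/7.5.5 (p. 397). [Spanier1981]
* A. Hatcher, *Algebraic Topology*, CUP (2002), §4.1 pp. 340–341, §4.2 Thm. 4.32. [HatcherAT2002]
-/

noncomputable section

open Set Function
open scoped unitInterval Topology Topology.Homotopy
open Literature.AlgebraicTopology.Homotopy Literature.AlgebraicTopology.Homotopy.CubeHAT

universe u

namespace Literature.AlgebraicTopology.SingularHomology

open CubeCollapse

variable {X : Type u} [TopologicalSpace X] {x₀ : X} {n : ℕ}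

/-! ### The class of a based simplex through the collapse -/

variable (n) in
/-- The collapse `κₙ : Iⁿ → Δⁿ` as a bundled continuous map. [folklore] -/
def cubeCollapse : C(Fin n → I, StdSimplex n) := ⟨collapse, continuous_collapse⟩

/-- `cubeCollapse` is `collapse`. [folklore] -/
@[simp] lemma cubeCollapse_apply (t : Fin n → I) : cubeCollapse n t = collapse t := rfl

/-- The collapse is a quotient map (bundled form). [folklore] -/
lemma isQuotientMap_cubeCollapse : Topology.IsQuotientMap (cubeCollapse n) := isQuotientMap_collapse

/-- **The generalized loop `g ∘ κₙ`** of a singular simplex `g : (Δⁿ, ∂Δⁿ) → (X, x₀)` (Spanier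
1981, Ch. 7 §4, p. 391). [cite: Spanier1981, Ch. 7 §4 p. 391] -/
def collapseLoop (g : C(StdSimplex n, X)) (hg : ∀ t ∈ stdBoundary n, g t = x₀) : Ω^ (Fin n) X x₀ :=
  ⟨g.comp (cubeCollapse n), fun _ ht => hg _ (collapse_mem_stdBoundary ht)⟩

/-- `collapseLoop` pointwise. [folklore] -/
@[simp] lemma collapseLoop_apply (g : C(StdSimplex n, X)) (hg : ∀ t ∈ stdBoundary n, g t = x₀)
    (t : Fin n → I) : collapseLoop g hg t = g (collapse t) := rfl

/-- **The class `[g ∘ κₙ] ∈ πₙ(X, x₀)` of a singular simplex `g : (Δⁿ, ∂Δⁿ) → (X, x₀)`** (Spanier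
1981, Ch. 7 §5: the element `[σ]` of a simplex of `Δ(X, {x₀}, x₀)ⁿ⁻¹`). [cite: Spanier1981, Ch. 7 §5 p. 397] -/
def collapseClass (g : C(StdSimplex n, X)) (hg : ∀ t ∈ stdBoundary n, g t = x₀) : π_ n X x₀ :=
  ⟦collapseLoop g hg⟧

/-- **(ii) The constant simplex has trivial class** (Spanier 1981, p. 394). [cite: Spanier1981, Ch. 7 §5 p. 394] -/
theorem collapseClass_const [NeZero n] :
    collapseClass (ContinuousMap.const (StdSimplex n) x₀) (fun _ _ => rfl) = (1 : π_ n X x₀) := by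
  rw [collapseClass, HomotopyGroup.one_def]
  exact congrArg (Quotient.mk _) (Subtype.ext (by ext; rfl))

/-- A generalized loop is constant on the fibres of the collapse. [folklore] -/
lemma factorsThrough_collapse (p : Ω^ (Fin n) X x₀) :
    Function.FactorsThrough (p : C(Fin n → I, X)) (cubeCollapse n) := by
  intro t t' h
  change collapse t = collapse t' at h
  by_cases ht : t ∈ Cube.boundary (Fin n)
  · have ht' : t' ∈ Cube.boundary (Fin n) := by
      by_contra h'
      exact collapse_not_mem_stdBoundary h' (h ▸ collapse_mem_stdBoundary ht)
    change p t = p t'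
    rw [GenLoop.boundary p _ ht, GenLoop.boundary p _ ht']
  · rw [eq_of_collapse_eq h ht]

/-- **(i) Every element of `πₙ(X, x₀)` is the class `[g ∘ κₙ]` of a singular simplex
`g : (Δⁿ, ∂Δⁿ) → (X, x₀)`** (Spanier 1981, p. 393: "any element of `πₙ(X, A, x₀)` can be
represented by such a map `α`"): descend a representative along the quotient map `κₙ`.
[cite: Spanier1981, Ch. 7 §5 p. 393] -/
theorem collapseClass_surjective (a : π_ n X x₀) :
    ∃ (g : C(StdSimplex n, X)) (hg : ∀ t ∈ stdBoundary n, g t = x₀), collapseClass g hg = a := by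
  induction a using Quotient.inductionOn with
  | h p =>
    set g : C(StdSimplex n, X) :=
      isQuotientMap_cubeCollapse.lift (p : C(Fin n → I, X)) (factorsThrough_collapse p) with hgdef
    have hgκ : g.comp (cubeCollapse n) = (p : C(Fin n → I, X)) :=
      isQuotientMap_cubeCollapse.lift_comp _ _
    have hg : ∀ t ∈ stdBoundary n, g t = x₀ := by
      intro t ht
      obtain ⟨s, rfl⟩ := collapse_surjective t
      have hs : s ∈ Cube.boundary (Fin n) := by
        by_contra h'
        exact collapse_not_mem_stdBoundary h' ht
      have := congrFun (congrArg DFunLike.coe hgκ) s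
      change g (collapse s) = p s at this
      rw [this, GenLoop.boundary p _ hs]
    refine ⟨g, hg, congrArg (Quotient.mk _) (Subtype.ext ?_)⟩
    change g.comp (cubeCollapse n) = (p : C(Fin n → I, X))
    exact hgκ

/-! ### A singular simplex read through the collapse is a cube constant on the skeleton -/

/-- Two distinct vanishing barycentric coordinates put a point of `Δᵐ⁺²` in the `m`-skeleton.
[folklore] -/
lemma mem_stdSkel_of_two_eq_zero {m : ℕ} (z : StdSimplex (m + 2)) {a b : Fin (m + 3)} (hab : a ≠ b)
    (ha : (z : Fin (m + 3) → ℝ) a = 0) (hb : (z : Fin (m + 3) → ℝ) b = 0) : z ∈ stdSkel (m + 2) m := by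
  rw [mem_stdSkel_iff]
  have hsub : StdSimplex.nzCoords z ⊆ (Finset.univ.erase a).erase b := fun i hi => by
    rw [StdSimplex.mem_nzCoords] at hi
    rw [Finset.mem_erase, Finset.mem_erase]
    exact ⟨fun h => hi (h ▸ hb), fun h => hi (h ▸ ha), Finset.mem_univ _⟩
  refine (Finset.card_le_card hsub).trans ?_
  rw [Finset.card_erase_of_mem (Finset.mem_erase.2 ⟨hab.symm, Finset.mem_univ _⟩),
    Finset.card_erase_of_mem (Finset.mem_univ _), Finset.card_univ, Fintype.card_fin]
  omega

/-- The coordinate `l` of the collapse vanishes on the face `{tₗ = 1}`. [folklore] -/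
lemma collapse_apply_castSucc_of_eq_one {t : Fin n → I} {l : Fin n} (hl : t l = 1) :
    (collapse t : Fin (n + 1) → ℝ) l.castSucc = 0 := by
  change coordFun t l.castSucc = 0
  rw [coordFun_of_lt t l.castSucc l.2]
  simp [hl]

/-- The coordinates beyond `l` of the collapse vanish on the face `{tₗ = 0}`. [folklore] -/
lemma collapse_apply_of_eq_zero {t : Fin n → I} {l : Fin n} (hl : t l = 0) {j : Fin (n + 1)}
    (hj : (l : ℕ) < j) : (collapse t : Fin (n + 1) → ℝ) j = 0 := by
  have h0 : pp t (l + 1) = 0 := by rw [pp_succ t l.2, tval_of_lt t l.2, hl]; simp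
  change pp t j - pp t (j + 1) = 0
  rw [pp_eq_zero_of_le t h0 (by omega), pp_eq_zero_of_le t h0 (by omega), sub_zero]

/-- **A point of `Iᵐ⁺²` with two distinct extreme coordinates goes to the `m`-skeleton of `Δᵐ⁺²`**
(each `tₗ = 1` kills the coordinate `l`, each `tₗ = 0` kills all coordinates beyond `l`).
[folklore] -/
theorem collapse_mem_stdSkel_of_two {m : ℕ} {t : Fin (m + 2) → I} {i j : Fin (m + 2)} (hij : i ≠ j)
    (hi : IsExtreme (t i)) (hj : IsExtreme (t j)) : collapse t ∈ stdSkel (m + 2) m := by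
  have hlast : ∀ l : Fin (m + 2), (l : ℕ) < ((Fin.last (m + 2) : Fin (m + 3)) : ℕ) := fun l => by
    rw [Fin.val_last]; exact l.2
  rcases hi with hi | hi <;> rcases hj with hj | hj
  · -- both `0`: order them
    rcases lt_or_gt_of_ne (fun h : (i : ℕ) = j => hij (Fin.ext h)) with h | h
    · exact mem_stdSkel_of_two_eq_zero _ (fun h' => by
          have := congrArg Fin.val h'; rw [Fin.val_castSucc, Fin.val_last] at this; omega)
        (collapse_apply_of_eq_zero hi (j := j.castSucc) (by rw [Fin.val_castSucc]; exact h))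
        (collapse_apply_of_eq_zero hi (hlast i))
    · exact mem_stdSkel_of_two_eq_zero _ (fun h' => by
          have := congrArg Fin.val h'; rw [Fin.val_castSucc, Fin.val_last] at this; omega)
        (collapse_apply_of_eq_zero hj (j := i.castSucc) (by rw [Fin.val_castSucc]; exact h))
        (collapse_apply_of_eq_zero hj (hlast j))
  · exact mem_stdSkel_of_two_eq_zero _ (fun h' => by
        have := congrArg Fin.val h'; rw [Fin.val_castSucc, Fin.val_last] at this; omega)
      (collapse_apply_castSucc_of_eq_one hj) (collapse_apply_of_eq_zero hi (hlast i))
  · exact mem_stdSkel_of_two_eq_zero _ (fun h' => by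
        have := congrArg Fin.val h'; rw [Fin.val_castSucc, Fin.val_last] at this; omega)
      (collapse_apply_castSucc_of_eq_one hi) (collapse_apply_of_eq_zero hj (hlast j))
  · exact mem_stdSkel_of_two_eq_zero _ (fun h' => hij (Fin.castSucc_injective _ h'))
      (collapse_apply_castSucc_of_eq_one hi) (collapse_apply_castSucc_of_eq_one hj)

section HomotopyAdditionSimplex

variable {k : ℕ} (τ : C(StdSimplex (k + 3), X)) (hτ : ∀ t ∈ stdSkel (k + 3) (k + 1), τ t = x₀)

/-- The singular cube `τ ∘ κ_{k+3}` of a simplex `τ : Δᵏ⁺³ → X`. [folklore] -/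
def cubeOf : C(Fin (k + 3) → I, X) := τ.comp (cubeCollapse (k + 3))

/-- `cubeOf` pointwise. [folklore] -/
@[simp] lemma cubeOf_apply (t : Fin (k + 3) → I) : cubeOf τ t = τ (collapse t) := rfl

include hτ in
/-- **`τ ∘ κ` is constant on the codimension-two skeleton of the cube** when `τ` is constant on
the `(k+1)`-skeleton of `Δᵏ⁺³`. [folklore] -/
theorem isSkelConst_cubeOf : IsSkelConst x₀ (cubeOf τ) :=
  fun _ _ _ hij hi hj => hτ _ (collapse_mem_stdSkel_of_two hij hi hj)

/-- The faces `{tⱼ = 1}` of `τ ∘ κ` are the faces `τ ∘ δⱼ`, `j ≤ k + 2`, read through `κ`.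
[folklore] -/
lemma faceClass_cubeOf_one (j : Fin (k + 3)) :
    faceClass (cubeOf τ) (isSkelConst_cubeOf τ hτ) j 1 isExtreme_one =
      collapseClass (τ.comp (stdFace j.castSucc)) (comp_stdFace_apply_of_mem_stdSkel τ hτ _) :=
  congrArg (Quotient.mk _) (Subtype.ext (ContinuousMap.ext fun t => by
    change τ (collapse (Fin.insertNth j 1 t)) = τ (stdFace j.castSucc (collapse t))
    rw [collapse_insertNth_one]))

/-- The face `{t_{k+2} = 0}` of `τ ∘ κ` is the last face `τ ∘ δ_{k+3}` read through `κ`. [folklore] -/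
lemma faceClass_cubeOf_last_zero :
    faceClass (cubeOf τ) (isSkelConst_cubeOf τ hτ) (Fin.last (k + 2)) 0 isExtreme_zero =
      collapseClass (τ.comp (stdFace (Fin.last (k + 3)))) (comp_stdFace_apply_of_mem_stdSkel τ hτ _) :=
  congrArg (Quotient.mk _) (Subtype.ext (ContinuousMap.ext fun t => by
    change τ (collapse (Fin.insertNth (Fin.last (k + 2)) 0 t)) = τ (stdFace (Fin.last (k + 3)) (collapse t))
    rw [collapse_insertNth_last_zero]))

/-- The faces `{tⱼ = 0}`, `j < k + 2`, of `τ ∘ κ` are constant. [folklore] -/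
lemma faceClass_cubeOf_zero_of_ne_last {j : Fin (k + 3)} (hj : j ≠ Fin.last (k + 2)) :
    faceClass (cubeOf τ) (isSkelConst_cubeOf τ hτ) j 0 isExtreme_zero = 1 := by
  refine faceClass_eq_one_of_forall (N := k + 2) _ isExtreme_zero fun t => ?_
  rw [cubeOf_apply]
  refine hτ _ (stdSkel_mono _ ?_ (collapse_insertNth_zero_mem_stdSkel j t))
  have := Fin.val_lt_last hj
  omega

/-- **(iii) The homotopy addition theorem for singular simplices**: for `τ : Δᵏ⁺³ → X` constant
`= x₀` on the `(k+1)`-skeleton, `∏ᵢ [τ ∘ δᵢ ∘ κ]^((-1)ⁱ) = 1` in `π_{k+2}(X, x₀)` — the cubical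
homotopy addition theorem applied to the cube `τ ∘ κ_{k+3}` (Spanier 1981, Ch. 7 §5, Prop. 3 via
part (d): `∑ (-1)ⁱ [σ⁽ⁱ⁾] = 0`). [cite: Spanier1981, Ch. 7 §5 Prop. 3] -/
theorem prod_collapseClass_face_zpow_eq_one :
    ∏ i : Fin (k + 4), collapseClass (τ.comp (stdFace i)) (comp_stdFace_apply_of_mem_stdSkel τ hτ i) ^
      ((-1 : ℤ) ^ (i : ℕ)) = 1 := by
  -- the cubical homotopy addition theorem for the cube `τ ∘ κ`
  have hG := prod_face_class_zpow_eq_one (cubeOf τ) (isSkelConst_cubeOf τ hτ)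
  -- its factors: `[τ ∘ δⱼ]^{s j}` for `j < k + 2`, and `([τ ∘ δ_{k+2}] [τ ∘ δ_{k+3}]⁻¹)^{s (k+2)}`
  have key : ∀ j : Fin (k + 3),
      (faceClass (cubeOf τ) (isSkelConst_cubeOf τ hτ) j 1 isExtreme_one *
        (faceClass (cubeOf τ) (isSkelConst_cubeOf τ hτ) j 0 isExtreme_zero)⁻¹) ^ ((-1 : ℤ) ^ (j : ℕ)) =
      collapseClass (τ.comp (stdFace j.castSucc)) (comp_stdFace_apply_of_mem_stdSkel τ hτ _) ^
          ((-1 : ℤ) ^ (j : ℕ)) *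
        (if j = Fin.last (k + 2) then
          collapseClass (τ.comp (stdFace (Fin.last (k + 3)))) (comp_stdFace_apply_of_mem_stdSkel τ hτ _) ^
            (-((-1 : ℤ) ^ (j : ℕ)))
         else 1) := by
    intro j
    by_cases hj : j = Fin.last (k + 2)
    · subst hj
      rw [if_pos rfl, faceClass_cubeOf_one τ hτ, faceClass_cubeOf_last_zero τ hτ, mul_zpow, inv_zpow',
        zpow_neg]
    · rw [if_neg hj, faceClass_cubeOf_one τ hτ, faceClass_cubeOf_zero_of_ne_last τ hτ hj, inv_one,
        mul_one, mul_one]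
  rw [Finset.prod_congr rfl (fun j _ => key j), Finset.prod_mul_distrib, Finset.prod_ite_eq'] at hG
  simp only [Finset.mem_univ, if_true] at hG
  -- reindex `Fin (k + 4) = Fin (k + 3) ⊔ {last}`
  rw [Fin.prod_univ_castSucc]
  convert hG using 2
  · refine Finset.prod_congr rfl fun j _ => ?_
    rw [Fin.val_castSucc]
  · rw [Fin.val_last, Fin.val_last, pow_succ, mul_neg_one]

end HomotopyAdditionSimplex

/-! ### Discharge of the named fact -/

/-- **Homotopy addition data from the collapse device**: `cls = collapseClass` with
(i) `collapseClass_surjective`, (ii) `collapseClass_const`, (iii)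
`prod_collapseClass_face_zpow_eq_one`. [folklore] -/
def collapseHomotopyAdditionData (X : Type u) [TopologicalSpace X] (x₀ : X) (k : ℕ) :
    HomotopyAdditionData X x₀ k where
  cls g hg := collapseClass g hg
  cls_surjective a := collapseClass_surjective a
  cls_const := collapseClass_const
  prod_cls_face_zpow_eq_one τ hτ := prod_collapseClass_face_zpow_eq_one τ hτ

/-- **The homotopy addition theorem** (discharge of the named fact `homotopyAddition`; Spanier,
*Algebraic Topology* (1981), Ch. 7 §5 Prop. 3 in the consumed form: for every space, base point
and `k`, classes `[g] ∈ π_{k+2}(X, x₀)` of the singular simplices `g : (Δᵏ⁺², ∂Δᵏ⁺²) → (X, x₀)`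
reaching every element, trivial on the constant simplex, with `∏ᵢ [τ ∘ δᵢ]^((-1)ⁱ) = 1` for every
`τ : Δᵏ⁺³ → X` constant on the `(k+1)`-skeleton). PROVED, through the collapse `κ : Iⁿ → Δⁿ`
and the cubical homotopy addition theorem. [cite: Spanier1981, Ch. 7 §5 Prop. 3] -/
theorem homotopyAddition_holds : homotopyAddition.{u} :=
  fun X _ x₀ k => ⟨collapseHomotopyAdditionData X x₀ k⟩


end Literature.AlgebraicTopology.SingularHomology

end
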